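import Summits.QuantumAdvantage.QuantumAdvantage.Theorems.CubicForrelationNearExactIsExactAmmAccountingA
import Summits.QuantumAdvantage.QuantumAdvantage.Theorems.CubicForrelationNearExactIsExactAmmCeilingX

/-!
# Crux `CubicForrelation.NearExactIsExact` (stmt-QuantumAdvantage-14043) — fibre accounting of the almost-MM ceiling

Line `direct-sum-amplification`, stub `stub_ammAccounting` (tag AA) for the crux
`Summit.QuantumAdvantage.QuantumAdvantage.Theses.CubicForrelation.NearExactIsExact`; its first hypothesis is the
statement of the four-point lemma (stub `stub_fourPoint`, proved separately).

**What.** For cubic `f` on `a + (a+2)` bits, ANY map `φ : 𝔽₂^{a+2} → 𝔽₂^a` and any `h : 𝔽₂^{a+2} → 𝔽₂`, write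
`K = 2^{a+2}`, `c_{x₁} = f(x₁ ‖ ·)`, `W_{x₁} = W_{(−1)^{c_{x₁}}}`, `T(y) = (−1)^{h y} W_{φ y}(y)`,
`Φ′ = 2^{−(2a+3)} ∑_y T(y)` (the forrelation of `f` with the almost-Maiorana–McFarland `g` built from `φ, h`, by the
landed `stub_ammWalsh`; `g` plays no role here).  Call `x₁` GOOD when the fibre `φ⁻¹(x₁)` has exactly `4` points and
`T = K/2` on them.  Then `#BAD ≤ 2^{a+4} (1 − Φ′)` (`stub_ammAccounting`).

**Proof.** `aa_identity` (★): regrouping the sums over `y` along the fibres of `φ` (`Finset.sum_fiberwise`),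
`∑_{x₁} cost(x₁) = 2^{a+1} K² (1 − Φ′)` for the fibre cost
`cost(x₁) = K² − ∑_{φ y = x₁} W_{x₁}(y)² + ∑_{φ y = x₁} (T(y) − K/2)² ≥ 0` (Parseval).  By the per-fibre lemma
`aa_fibre` of file A — fed with the four-point lemma applied to the cubic slice `c_{x₁}` (`acx_deg_slice`), whose
aligned form has Walsh values in `(K/2)ℤ` (`aa_W_halfInt`) — every `x₁` of cost `< K²/8` is GOOD, so
`#BAD · K²/8 ≤ 2^{a+1} K² (1 − Φ′)`.

Sources (orientation only): R. O'Donnell, Analysis of Boolean Functions (CUP 2014), §1.4; S. Aaronson, A. Ambainis,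
Forrelation, SIAM J. Comput. 47 (2018), §1.1.1.  Everything is proved; axioms standard.
-/

set_option linter.dupNamespace false -- D-0017: single-problem summit

namespace Summit.QuantumAdvantage.QuantumAdvantage.Theorems.CubicForrelation.NearExactIsExact

open Finset
open Literature.Computability.QuantumComplexity
open Literature.Computability.QuantumComplexity.BuzetChailloux (bxor zeroVec signOf_sq)
open Literature.Computability.QuantumComplexity.DerivativeWalsh (W)

/-! ### The accounting identity and the count of bad fibres -/

/-- **The accounting identity** (★). With `K = 2^{a+2}`, `c_{x₁} = f(x₁ ‖ ·)`, `T(y) = (−1)^{h y} W_{c_{φ y}}(y)`: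
`∑_{x₁} (K² − ∑_{y : φ y = x₁} W_{c_{x₁}}(y)² + ∑_{y : φ y = x₁} (T(y) − K/2)²) = 2^{a+1} K² (1 − 2^{−(2a+3)} ∑_y T(y))`
(regroup the sums over `y` along the fibres of `φ` and expand the square, `(−1)^{2h} = 1`). [folklore] -/
theorem aa_identity {a : ℕ} (f : (Fin (a + (a + 2)) → Bool) → Bool)
    (φ : (Fin (a + 2) → Bool) → (Fin a → Bool)) (h : (Fin (a + 2) → Bool) → Bool) :
    ∑ x₁ : Fin a → Bool, (((2 : ℝ) ^ (a + 2)) ^ 2 -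
        ∑ y ∈ univ.filter (fun y : Fin (a + 2) → Bool => φ y = x₁),
          W (fun x₂ => signOf (f (Fin.append x₁ x₂))) y ^ 2 +
        ∑ y ∈ univ.filter (fun y : Fin (a + 2) → Bool => φ y = x₁),
          (signOf (h y) * W (fun x₂ => signOf (f (Fin.append x₁ x₂))) y - (2 : ℝ) ^ (a + 2) / 2) ^ 2) =
      (2 : ℝ) ^ (a + 1) * ((2 : ℝ) ^ (a + 2)) ^ 2 * (1 - ((2 : ℝ) ^ (2 * a + 3))⁻¹ *
        ∑ y₂ : Fin (a + 2) → Bool, signOf (h y₂) *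
          ∑ x₂ : Fin (a + 2) → Bool, signOf (f (Fin.append (φ y₂) x₂)) * twist x₂ y₂) := by
  -- regrouping a sum over `y` along the fibres of `φ`
  have hfib : ∀ F : (Fin a → Bool) → (Fin (a + 2) → Bool) → ℝ,
      ∑ x₁ : Fin a → Bool, ∑ y ∈ univ.filter (fun y : Fin (a + 2) → Bool => φ y = x₁), F x₁ y =
        ∑ y, F (φ y) y := by
    intro F
    calc ∑ x₁ : Fin a → Bool, ∑ y ∈ univ.filter (fun y : Fin (a + 2) → Bool => φ y = x₁), F x₁ y
        = ∑ x₁ : Fin a → Bool, ∑ y ∈ univ.filter (fun y : Fin (a + 2) → Bool => φ y = x₁), F (φ y) y :=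
          sum_congr rfl fun x₁ _ => sum_congr rfl fun y hy => by rw [(mem_filter.1 hy).2]
      _ = ∑ y, F (φ y) y := Finset.sum_fiberwise univ φ fun y => F (φ y) y
  have e1 : ∑ x₁ : Fin a → Bool, ∑ y ∈ univ.filter (fun y : Fin (a + 2) → Bool => φ y = x₁),
      W (fun x₂ => signOf (f (Fin.append x₁ x₂))) y ^ 2 =
        ∑ y, W (fun x₂ => signOf (f (Fin.append (φ y) x₂))) y ^ 2 :=
    hfib fun x₁ y => W (fun x₂ => signOf (f (Fin.append x₁ x₂))) y ^ 2
  have e2 : ∑ x₁ : Fin a → Bool, ∑ y ∈ univ.filter (fun y : Fin (a + 2) → Bool => φ y = x₁),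
      (signOf (h y) * W (fun x₂ => signOf (f (Fin.append x₁ x₂))) y - (2 : ℝ) ^ (a + 2) / 2) ^ 2 =
        ∑ y, (signOf (h y) * W (fun x₂ => signOf (f (Fin.append (φ y) x₂))) y - (2 : ℝ) ^ (a + 2) / 2) ^ 2 :=
    hfib fun x₁ y => (signOf (h y) * W (fun x₂ => signOf (f (Fin.append x₁ x₂))) y - (2 : ℝ) ^ (a + 2) / 2) ^ 2
  -- expanding the square
  have e3 : ∀ y : Fin (a + 2) → Bool,
      (signOf (h y) * W (fun x₂ => signOf (f (Fin.append (φ y) x₂))) y - (2 : ℝ) ^ (a + 2) / 2) ^ 2 =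
        W (fun x₂ => signOf (f (Fin.append (φ y) x₂))) y ^ 2 -
          (2 : ℝ) ^ (a + 2) * (signOf (h y) * W (fun x₂ => signOf (f (Fin.append (φ y) x₂))) y) +
          ((2 : ℝ) ^ (a + 2)) ^ 2 / 4 := by
    intro y
    have hs : signOf (h y) = 1 ∨ signOf (h y) = -1 := by cases h y <;> simp [signOf]
    rcases hs with hs | hs <;> rw [hs] <;> ring
  have hT : ∑ y₂ : Fin (a + 2) → Bool, signOf (h y₂) *
      ∑ x₂ : Fin (a + 2) → Bool, signOf (f (Fin.append (φ y₂) x₂)) * twist x₂ y₂ =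
        ∑ y, signOf (h y) * W (fun x₂ => signOf (f (Fin.append (φ y) x₂))) y := rfl
  have hpow : ∀ t : ℝ, (2 : ℝ) ^ (a + 1) * ((2 : ℝ) ^ (a + 2)) ^ 2 * (((2 : ℝ) ^ (2 * a + 3))⁻¹ * t) =
      (2 : ℝ) ^ (a + 2) * t := by
    intro t
    have h2 : (2 : ℝ) ^ (2 * a + 3) ≠ 0 := by positivity
    field_simp
    ring
  rw [sum_add_distrib, sum_sub_distrib, e1, e2, sum_const, nsmul_eq_mul, aa_card_univ,
    sum_congr rfl fun y _ => e3 y, sum_add_distrib, sum_sub_distrib, ← mul_sum, sum_const, nsmul_eq_mul,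
    aa_card_univ, hT, mul_sub, mul_one, hpow]
  ring

/-- **Fibre accounting of the almost-Maiorana–McFarland ceiling** (stub `stub_ammAccounting`, tag AA, of the line
`direct-sum-amplification`; its first hypothesis is the four-point lemma, stub `stub_fourPoint`).  For cubic `f` on
`a + (a+2)` bits, ANY map `φ : 𝔽₂^{a+2} → 𝔽₂^a` and any `h`, write `K = 2^{a+2}`, `c_{x₁} = f(x₁ ‖ ·)`,
`W_{x₁} = W_{(−1)^{c_{x₁}}}` (so `∑_y W_{x₁}(y)² = K²`), `T(y) = (−1)^{h y} W_{φ y}(y)` and `Φ′ = 2^{−(2a+3)} ∑_y T(y)`.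
Call `x₁` GOOD when its fibre `φ⁻¹(x₁)` has exactly `4` points and `T = K/2` on them.  Then `#BAD ≤ 2^{a+4}(1 − Φ′)`.
Proof: the accounting identity `aa_identity` writes `2^{a+1}K²(1 − Φ′)` as the sum over `x₁` of the non-negative
fibre costs `K² − ∑_{φ y = x₁} W_{x₁}(y)² + ∑_{φ y = x₁} (T(y) − K/2)²`, and by the per-fibre lemma `aa_fibre`
(Parseval, the integrality bound `aa_sum_abs_W_le`, and the four-point lemma applied to the cubic slice `c_{x₁}`,
whose aligned form has Walsh values in `(K/2)ℤ`) every fibre of cost `< K²/8` is GOOD. [folklore] -/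
theorem stub_ammAccounting :
    (∀ (k : ℕ) (c : (Fin k → Bool) → Bool) (y₁ y₂ y₃ y₄ : Fin k → Bool), IsDegLeFun 3 c →
      y₁ ≠ y₂ → y₁ ≠ y₃ → y₁ ≠ y₄ → y₂ ≠ y₃ → y₂ ≠ y₄ → y₃ ≠ y₄ →
      (15 / 8 : ℝ) * (2 : ℝ) ^ k < |W (fun x => signOf (c x)) y₁| + |W (fun x => signOf (c x)) y₂| +
        |W (fun x => signOf (c x)) y₃| + |W (fun x => signOf (c x)) y₄| →
      ∃ (s u v : Fin k → Bool) (e : Bool), u ≠ zeroVec ∧ v ≠ zeroVec ∧ u ≠ v ∧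
        (∀ x, signOf (c x) = signOf e * twist s x * ((1 + twist u x + twist v x - twist u x * twist v x) / 2)) ∧
        ({y₁, y₂, y₃, y₄} : Finset (Fin k → Bool)) = {s, bxor s u, bxor s v, bxor s (bxor u v)}) →
    ∀ (a : ℕ) (f : (Fin (a + (a + 2)) → Bool) → Bool) (φ : (Fin (a + 2) → Bool) → (Fin a → Bool))
      (h : (Fin (a + 2) → Bool) → Bool), IsDegLeFun 3 f →
      ((univ.filter fun x₁ : Fin a → Bool => ¬ ((univ.filter fun y : Fin (a + 2) → Bool => φ y = x₁).card = 4 ∧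
          ∀ y : Fin (a + 2) → Bool, φ y = x₁ →
            signOf (h y) * W (fun x₂ => signOf (f (Fin.append x₁ x₂))) y = (2 : ℝ) ^ (a + 2) / 2)).card : ℝ) ≤
        (2 : ℝ) ^ (a + 4) * (1 - ((2 : ℝ) ^ (2 * a + 3))⁻¹ *
          ∑ y₂ : Fin (a + 2) → Bool, signOf (h y₂) *
            ∑ x₂ : Fin (a + 2) → Bool, signOf (f (Fin.append (φ y₂) x₂)) * twist x₂ y₂) := by
  intro hFP a f φ h hf
  have hsg : ∀ b : Bool, signOf b = 1 ∨ signOf b = -1 := fun b => by cases b <;> simp [signOf]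
  -- every BAD fibre costs at least `K²/8` …
  have hbad : ∀ x₁ ∈ (univ.filter fun x₁ : Fin a → Bool =>
      ¬ ((univ.filter fun y : Fin (a + 2) → Bool => φ y = x₁).card = 4 ∧
        ∀ y : Fin (a + 2) → Bool, φ y = x₁ →
          signOf (h y) * W (fun x₂ => signOf (f (Fin.append x₁ x₂))) y = (2 : ℝ) ^ (a + 2) / 2)),
      ((2 : ℝ) ^ (a + 2)) ^ 2 / 8 ≤ ((2 : ℝ) ^ (a + 2)) ^ 2 -
        ∑ y ∈ univ.filter (fun y : Fin (a + 2) → Bool => φ y = x₁),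
          W (fun x₂ => signOf (f (Fin.append x₁ x₂))) y ^ 2 +
        ∑ y ∈ univ.filter (fun y : Fin (a + 2) → Bool => φ y = x₁),
          (signOf (h y) * W (fun x₂ => signOf (f (Fin.append x₁ x₂))) y - (2 : ℝ) ^ (a + 2) / 2) ^ 2 := by
    intro x₁ hx₁
    rw [mem_filter] at hx₁
    by_contra hlt
    push Not at hlt
    -- the four-point lemma on the cubic slice `c_{x₁}`: its Walsh values are then in `(K/2)ℤ`
    have hq : ∀ y₁ y₂ y₃ y₄ : Fin (a + 2) → Bool, y₁ ≠ y₂ → y₁ ≠ y₃ → y₁ ≠ y₄ → y₂ ≠ y₃ → y₂ ≠ y₄ →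
        y₃ ≠ y₄ →
        (15 / 8 : ℝ) * (2 : ℝ) ^ (a + 2) < |W (fun x₂ => signOf (f (Fin.append x₁ x₂))) y₁| +
          |W (fun x₂ => signOf (f (Fin.append x₁ x₂))) y₂| + |W (fun x₂ => signOf (f (Fin.append x₁ x₂))) y₃| +
          |W (fun x₂ => signOf (f (Fin.append x₁ x₂))) y₄| →
        ∀ y, ∃ j : ℤ, W (fun x₂ => signOf (f (Fin.append x₁ x₂))) y = (2 : ℝ) ^ (a + 2) / 2 * j := by
      intro y₁ y₂ y₃ y₄ h12 h13 h14 h23 h24 h34 hlt' y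
      obtain ⟨s, u, v, e, -, -, -, hsign, -⟩ := hFP (a + 2) (fun x₂ => f (Fin.append x₁ x₂)) y₁ y₂ y₃ y₄
        (acx_deg_slice hf x₁) h12 h13 h14 h23 h24 h34 hlt'
      exact aa_W_halfInt _ s u v e hsign y
    have hfib := aa_fibre (fun x₂ => signOf (f (Fin.append x₁ x₂))) (fun x₂ => hsg _)
      (fun y => signOf (h y)) (fun y => hsg _) _ hq hlt
    exact hx₁.2 ⟨hfib.1, fun y hy => hfib.2 y (mem_filter.2 ⟨mem_univ _, hy⟩)⟩
  -- … and every fibre has non-negative cost (Parseval on the slice)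
  have hnn : ∀ x₁ : Fin a → Bool, 0 ≤ ((2 : ℝ) ^ (a + 2)) ^ 2 -
      ∑ y ∈ univ.filter (fun y : Fin (a + 2) → Bool => φ y = x₁),
        W (fun x₂ => signOf (f (Fin.append x₁ x₂))) y ^ 2 +
      ∑ y ∈ univ.filter (fun y : Fin (a + 2) → Bool => φ y = x₁),
        (signOf (h y) * W (fun x₂ => signOf (f (Fin.append x₁ x₂))) y - (2 : ℝ) ^ (a + 2) / 2) ^ 2 := by
    intro x₁
    have h1 := aa_sum_W_sq_le (fun x₂ => signOf (f (Fin.append x₁ x₂))) (fun x₂ => hsg _)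
      (univ.filter fun y : Fin (a + 2) → Bool => φ y = x₁)
    have h2 : 0 ≤ ∑ y ∈ univ.filter (fun y : Fin (a + 2) → Bool => φ y = x₁),
        (signOf (h y) * W (fun x₂ => signOf (f (Fin.append x₁ x₂))) y - (2 : ℝ) ^ (a + 2) / 2) ^ 2 :=
      sum_nonneg fun y _ => sq_nonneg _
    linarith
  -- sum over the BAD `x₁` and compare with the accounting identity
  have hcount := ((sum_le_sum hbad).trans (sum_le_univ_sum_of_nonneg hnn)).trans_eq (aa_identity f φ h)
  rw [sum_const, nsmul_eq_mul] at hcount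
  have hK : (0 : ℝ) < ((2 : ℝ) ^ (a + 2)) ^ 2 / 8 := by positivity
  refine le_of_mul_le_mul_right (hcount.trans_eq ?_) hK
  ring

end Summit.QuantumAdvantage.QuantumAdvantage.Theorems.CubicForrelation.NearExactIsExact
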